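import Summits.NavierStokesRegularity.NavierStokesRegularity.Theses.DSolutionBubble
import HarnessLib

/-!
# Strategist sketch — BC2 redirect of `DSolutionBubble.NondegenerateBubbleBridge` (stmt-4062)

Pieces (typed over existing declarations only):
* `InnerWeightedSolvability` (X₁) — the INNER LINEAR THEORY (item 4384, so far informal) typed with explicit
  sup-weights: for every `ν > 0` and every smooth divergence-free `U` with a tame slow power tail, the
  linearised steady operator `φ ↦ −νΔφ + (U·∇)φ + (φ·∇)U + ∇π` is solvable, with a bounded right inverse into
  the finite-Dirichlet decaying bounded class, on a finite-codimensional subspace of the weighted-`C¹` sources.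
* `GluedBubbleWithRate` (X₂) — the gluing theorem GIVEN the linear theory, with its quantitative output: a
  classical Leray–Hopf solution from a rapidly decaying datum blowing up at `T` at least at a power rate
  `(T - t)^(-β)`, `β > 1/2`, along points of a bounded set.
Assembly `nondegenerateBubbleBridge_of_subs : X₁ → X₂ → NondegenerateBubbleBridge` proved below: the seam
carries two lemmas (power rate `β > 1/2` ⇒ not Type I; pointwise blow-up along a bounded set ⇒ no smooth
extension past `T`, by compactness/continuity of any extension).
-/

noncomputable section

set_option linter.dupNamespace false

namespace Summit.NavierStokesRegularity.NavierStokesRegularity.StrategistSketch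

open MeasureTheory Set Function Filter Topology Metric
open Literature.Analysis.FluidPDE

/-- X₁: inner weighted solvability (typed InnerLinearTheory). -/
def InnerWeightedSolvability : Prop :=
  ∀ ν : ℝ, 0 < ν → ∀ (U : EuclideanSpace ℝ (Fin 3) → EuclideanSpace ℝ (Fin 3)), ContDiff ℝ (⊤ : ℕ∞) U → Literature.Analysis.FluidPDE.VectorCalculus.IsDivFree U → (∃ a : ℝ, 1 / 2 < a ∧ a < 2 / 3 ∧ ∃ C c : ℝ, 0 < c ∧ (∀ y, ‖U y‖ ≤ C * (1 + ‖y‖) ^ (-a) ∧ ‖fderiv ℝ U y‖ ≤ C * (1 + ‖y‖) ^ (-(a + 1))) ∧ ∀ R : ℝ, 1 ≤ R → c * R ^ (3 - 2 * a) ≤ ∫ y in {y : EuclideanSpace ℝ (Fin 3) | R ≤ ‖y‖ ∧ ‖y‖ ≤ 2 * R}, ‖U y‖ ^ 2) → (∃ (b m Cs : ℝ) (k : ℕ) (ℓ : Fin k → ((EuclideanSpace ℝ (Fin 3) → EuclideanSpace ℝ (Fin 3)) →ₗ[ℝ] ℝ)), 0 < m ∧ ∀ h : EuclideanSpace ℝ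 (Fin 3) → EuclideanSpace ℝ (Fin 3), ContDiff ℝ 1 h → (∀ y, ‖h y‖ ≤ (1 + ‖y‖) ^ (-b) ∧ ‖fderiv ℝ h y‖ ≤ (1 + ‖y‖) ^ (-(b + 1))) → (∀ i, ℓ i h = 0) → ∃ (φ : EuclideanSpace ℝ (Fin 3) → EuclideanSpace ℝ (Fin 3)) (π : EuclideanSpace ℝ (Fin 3) → ℝ), ContDiff ℝ 2 φ ∧ ContDiff ℝ 1 π ∧ (∀ y, -(ν • Laplacian.laplacian φ y) + Literature.Analysis.FluidPDE.convect U φ y + Literature.Analysis.FluidPDE.convect φ U y + gradient π y = h y) ∧ Literature.Analysis.FluidPDE.VectorCalculus.IsDivFree φ ∧ ∀ y, ‖φ y‖ ≤ Cs * (1 + ‖y‖) ^ (-m))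

/-- X₂: the gluing theorem given the linear theory, with a power blow-up rate. -/
def GluedBubbleWithRate : Prop :=
  ∀ ν : ℝ, 0 < ν → ∀ (U : EuclideanSpace ℝ (Fin 3) → EuclideanSpace ℝ (Fin 3)) (P : EuclideanSpace ℝ (Fin 3) → ℝ), (Literature.Analysis.FluidPDE.IsLerayProfile ν 0 U P ∧ ContDiff ℝ (⊤ : ℕ∞) U ∧ ContDiff ℝ (⊤ : ℕ∞) P ∧ (∫⁻ y, ENNReal.ofReal (Literature.Analysis.FluidPDE.frobeniusNormSq (fderiv ℝ U y)) < ⊤) ∧ Filter.Tendsto U (Filter.cocompact (EuclideanSpace ℝ (Fin 3))) (nhds 0) ∧ U ≠ 0 ∧ (∃ a : ℝ, 1 / 2 < a ∧ a < 2 / 3 ∧ ∃ C c : ℝ, 0 < c ∧ (∀ y, ‖U y‖ ≤ C * (1 + ‖y‖) ^ (-a) ∧ ‖fderiv ℝ U y‖ ≤ C * (1 + ‖y‖) ^ (-(a + 1))) ∧ ∀ R : ℝ, 1 ≤ R → c * R ^ (3 - 2 * a) ≤ ∫ y in {y : EuclideanSpace ℝ (Fin 3) | R ≤ ‖y‖ ∧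 ‖y‖ ≤ 2 * R}, ‖U y‖ ^ 2) ∧ (∀ (φ : EuclideanSpace ℝ (Fin 3) → EuclideanSpace ℝ (Fin 3)) (π : EuclideanSpace ℝ (Fin 3) → ℝ), ContDiff ℝ 2 φ → ContDiff ℝ 1 π → (∀ y, -(ν • Laplacian.laplacian φ y) + Literature.Analysis.FluidPDE.convect U φ y + Literature.Analysis.FluidPDE.convect φ U y + gradient π y = 0) → Literature.Analysis.FluidPDE.VectorCalculus.IsDivFree φ → (∫⁻ y, ENNReal.ofReal (Literature.Analysis.FluidPDE.frobeniusNormSq (fderiv ℝ φ y)) < ⊤) → Filter.Tendsto φ (Filter.cocompact (EuclideanSpace ℝ (Fin 3))) (nhds 0) → ∃ (e : EuclideanSpace ℝ (Fin 3)) (s : ℝ) (A : EuclideanSpace ℝ (Fin 3) →ₗ[ℝ] EuclideanSpace ℝ (Fin 3)), (∀ x y : EuclideanSpace ℝ (Fin 3), @inner ℝ _ _ (A x) y = -(@inner ℝ _ _ x (A y))) ∧ ∀ y, φ y = fderiv ℝ U y e + s • (U y + fderiv ℝ U y y) + (A (U y) - fderiv ℝ U y (A y)))) → (∃ (b m Cs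 : ℝ) (k : ℕ) (ℓ : Fin k → ((EuclideanSpace ℝ (Fin 3) → EuclideanSpace ℝ (Fin 3)) →ₗ[ℝ] ℝ)), 0 < m ∧ ∀ h : EuclideanSpace ℝ (Fin 3) → EuclideanSpace ℝ (Fin 3), ContDiff ℝ 1 h → (∀ y, ‖h y‖ ≤ (1 + ‖y‖) ^ (-b) ∧ ‖fderiv ℝ h y‖ ≤ (1 + ‖y‖) ^ (-(b + 1))) → (∀ i, ℓ i h = 0) → ∃ (φ : EuclideanSpace ℝ (Fin 3) → EuclideanSpace ℝ (Fin 3)) (π : EuclideanSpace ℝ (Fin 3) → ℝ), ContDiff ℝ 2 φ ∧ ContDiff ℝ 1 π ∧ (∀ y, -(ν • Laplacian.laplacian φ y) + Literature.Analysis.FluidPDE.convect U φ y + Literature.Analysis.FluidPDE.convect φ U y + gradient π y = h y) ∧ Literature.Analysis.FluidPDE.VectorCalculus.IsDivFree φ ∧ ∀ y, ‖φ y‖ ≤ Cs * (1 + ‖y‖) ^ (-m)) → ∃ T : ℝ, 0 < T ∧ ∃ (u : ℝ → EuclideanSpace ℝ (Fin 3) → EuclideanSpace ℝ (Fin 3))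 (p : ℝ → EuclideanSpace ℝ (Fin 3) → ℝ), Literature.Analysis.FluidPDE.IsClassicalNSSolutionOn (Set.Ico 0 T) ν 0 u p ∧ Literature.Analysis.FluidPDE.IsLerayHopfOn T ν 0 (u 0) u ∧ Literature.Analysis.FluidPDE.HasRapidSpatialDecay (u 0) ∧ ∃ β ρ c : ℝ, 1 / 2 < β ∧ 0 < c ∧ ∀ t ∈ Set.Ico (0 : ℝ) T, ∃ x : EuclideanSpace ℝ (Fin 3), ‖x‖ ≤ ρ ∧ c ≤ (T - t) ^ β * ‖u t x‖

/-- A power rate `β > 1/2` along some points excludes the Type I bound. -/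
theorem not_isTypeIBlowup_of_rate {u : ℝ → EuclideanSpace ℝ (Fin 3) → EuclideanSpace ℝ (Fin 3)}
    {T β ρ c : ℝ} (hT : 0 < T) (hβ : 1 / 2 < β) (hc : 0 < c)
    (hrate : ∀ t ∈ Set.Ico (0 : ℝ) T, ∃ x : EuclideanSpace ℝ (Fin 3), ‖x‖ ≤ ρ ∧ c ≤ (T - t) ^ β * ‖u t x‖) :
    ¬ IsTypeIBlowup u T := by
  rintro ⟨C, hC⟩
  have hcont : ContinuousAt (fun t : ℝ => C * (T - t) ^ (β - 1 / 2)) T := by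
    have h1 : ContinuousAt (fun t : ℝ => T - t) T := (continuous_const.sub continuous_id).continuousAt
    have h2 : ContinuousAt (fun s : ℝ => s ^ (β - 1 / 2)) (T - T) := by
      apply Real.continuousAt_rpow_const
      right; linarith
    exact continuousAt_const.mul (h2.comp h1)
  have hlim : Tendsto (fun t : ℝ => C * (T - t) ^ (β - 1 / 2)) (𝓝[<] T) (𝓝 0) := by
    have := hcont.tendsto
    simp only [sub_self] at this
    rw [Real.zero_rpow (by linarith), mul_zero] at this
    exact tendsto_nhdsWithin_of_tendsto_nhds this
  have h3 : ∀ᶠ t in 𝓝[<] T, C * (T - t) ^ (β - 1 / 2) < c := hlim.eventually_lt_const hc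
  have h4 : ∀ᶠ t in 𝓝[<] T, t ∈ Set.Ico (0 : ℝ) T := Ico_mem_nhdsLT hT
  obtain ⟨t, ht, htI, hlt⟩ := (hC.and (h4.and h3)).exists
  obtain ⟨x, -, hcx⟩ := hrate t htI
  have hTt : 0 < T - t := sub_pos.2 htI.2
  have key : (T - t) ^ β * ‖u t x‖ ≤ C * (T - t) ^ (β - 1 / 2) := by
    calc (T - t) ^ β * ‖u t x‖ ≤ (T - t) ^ β * (C / Real.sqrt (T - t)) := by
          gcongr
          exact ht x
      _ = C * (T - t) ^ (β - 1 / 2) := by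
          rw [Real.sqrt_eq_rpow, Real.rpow_sub hTt]
          field_simp
  linarith

/-- Pointwise blow-up at a power rate along a bounded set excludes any smooth extension past `T`. -/
theorem not_hasSmoothExtensionPast_of_rate {ν : ℝ}
    {u : ℝ → EuclideanSpace ℝ (Fin 3) → EuclideanSpace ℝ (Fin 3)}
    {T β ρ c : ℝ} (hT : 0 < T) (hβ : 0 < β) (hc : 0 < c)
    (hrate : ∀ t ∈ Set.Ico (0 : ℝ) T, ∃ x : EuclideanSpace ℝ (Fin 3), ‖x‖ ≤ ρ ∧ c ≤ (T - t) ^ β * ‖u t x‖) :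
    ¬ HasSmoothExtensionPast ν 0 u T := by
  rintro ⟨T', hT', u', p', hcl', heq⟩
  have hcont : ContinuousOn (uncurry u') (Set.Icc (0 : ℝ) T ×ˢ closedBall (0 : EuclideanSpace ℝ (Fin 3)) ρ) :=
    hcl'.smooth_velocity.continuousOn.mono (prod_mono (Icc_subset_Ico_right hT') (subset_univ _))
  have hK : IsCompact (Set.Icc (0 : ℝ) T ×ˢ closedBall (0 : EuclideanSpace ℝ (Fin 3)) ρ) :=
    isCompact_Icc.prod (isCompact_closedBall 0 ρ)
  obtain ⟨M, hM⟩ := hK.exists_bound_of_continuousOn hcont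
  have hcontT : ContinuousAt (fun t : ℝ => (T - t) ^ β * |M|) T := by
    have h1 : ContinuousAt (fun t : ℝ => T - t) T := (continuous_const.sub continuous_id).continuousAt
    have h2 : ContinuousAt (fun s : ℝ => s ^ β) (T - T) := by
      apply Real.continuousAt_rpow_const
      right; exact hβ.le
    exact (h2.comp h1).mul continuousAt_const
  have hlim : Tendsto (fun t : ℝ => (T - t) ^ β * |M|) (𝓝[<] T) (𝓝 0) := by
    have := hcontT.tendsto
    simp only [sub_self] at this
    rw [Real.zero_rpow hβ.ne', zero_mul] at this
    exact tendsto_nhdsWithin_of_tendsto_nhds this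
  have h3 : ∀ᶠ t in 𝓝[<] T, (T - t) ^ β * |M| < c := hlim.eventually_lt_const hc
  have h4 : ∀ᶠ t in 𝓝[<] T, t ∈ Set.Ico (0 : ℝ) T := Ico_mem_nhdsLT hT
  obtain ⟨t, htI, hlt⟩ := (h4.and h3).exists
  obtain ⟨x, hx, hcx⟩ := hrate t htI
  have hTt : 0 < T - t := sub_pos.2 htI.2
  have hmem : (t, x) ∈ Set.Icc (0 : ℝ) T ×ˢ closedBall (0 : EuclideanSpace ℝ (Fin 3)) ρ :=
    ⟨⟨htI.1, htI.2.le⟩, mem_closedBall_zero_iff.2 hx⟩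
  have hbound : ‖u t x‖ ≤ |M| := by
    have h := hM (t, x) hmem
    simp only [uncurry_apply_pair] at h
    rw [heq t htI] at h
    exact h.trans (le_abs_self M)
  have key : (T - t) ^ β * ‖u t x‖ ≤ (T - t) ^ β * |M| := by
    gcongr
  linarith

/-- **Assembly** (BC2 redirect): the two pieces imply the crux `NondegenerateBubbleBridge`. -/
theorem nondegenerateBubbleBridge_of_subs (h₁ : InnerWeightedSolvability) (h₂ : GluedBubbleWithRate) :
    Theses.DSolutionBubble.NondegenerateBubbleBridge := by
  rintro ⟨ν, hν, U, P, hprof, hU, hP, hDir, hdec, hne, htail, hnd⟩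
  have hsolv := h₁ ν hν U hU hprof.divFree htail
  obtain ⟨T, hT, u, p, hcl, hLH, hdat, β, ρ, c, hβ, hc, hrate⟩ :=
    h₂ ν hν U P ⟨hprof, hU, hP, hDir, hdec, hne, htail, hnd⟩ hsolv
  exact ⟨ν, hν, T, hT, u, p, ⟨hcl, not_hasSmoothExtensionPast_of_rate hT (by linarith) hc hrate⟩, hLH, hdat,
    not_isTypeIBlowup_of_rate hT hβ hc hrate⟩

end Summit.NavierStokesRegularity.NavierStokesRegularity.StrategistSketch
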